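import Literature.AlgebraicGeometry.ShimuraVarieties.UnitaryCurveAuxiliarySymplecticAdelic
import Literature.AlgebraicGeometry.ShimuraVarieties.UnitaryAuxiliarySymplecticLevel
import HarnessLib

/-!
# Continuity of `ũ_β : U(H)(𝔸_f) × T₀(M)(𝔸_f) → GSp_δ(𝔸_{ℚ,f})` and openness of the auxiliary levels `K̃(m)`, IN ANY RANK `n`
# (Deligne 1979, Prop. 2.3.10 — topological clause of the group-map carrier; Deligne 1971, Prop. 1.15)

Topic `AlgebraicGeometry/ShimuraVarieties`; namespace `Literature.AlgebraicGeometry.ShimuraVarieties.UnitaryCurve.Aux`.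
One definition with body (`auxResFin`) and theorems; no named fact, no instance, nothing asserted (net debt 0).  Cell `hodgecm-mathlib` (D-0151), P6 «MOD
programme», door (E) organ **E1** (FILE 3 of 3): the RANK-`n` form of ★ `UnitaryAuxiliarySymplecticLevel` (= the case `n = 3`, namespace
`…UnitaryCanonicalModel.Aux`, untouched), `Fin 3 ↦ Fin n`, SAME NAMES; the unitary Shimura curve ([RapoportSmithlingZhang2020Diagonal] Remark 3.2) is
`n = 2`.  `--supports stmt-HodgeConjecture-24832`, count-neutral; HC_CM is proved only modulo the printed citations until rung 0 closes.  (At rank 3: layer (g-a4), second half, of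
the I-1′ receptacle (cell hodgecm-mathlib; B-plan2 RECEPTACLE-PLAN §7.5 Δ1: «`isOpen_auxLevel` (preimage of an open
subgroup under a continuous hom — continuity of `auxToGspFin β` is the one lemma to prove, from ★ `AdelicBaseChange`
continuity)».)  Over ★ E1 FILE 2 `UnitaryCurveAuxiliarySymplecticAdelic` (`auxToGspFin F`, `auxLevel F m := K_δ(m).comap ũ_β`)
and ★ (g-a4a) `SiegelPrincipalLevelOpen` (`isOpen_principalLevelSubgroup`).

The one mathematical point: the carrier `auxToGspFin F` is built through the base change `𝔸_{ℚ,f} ⊗_ℚ M ≅ 𝔸_{M,f}`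
(★ `ratFiniteAdeleTensorEquiv`), whose tensor side carries no topology.  Continuity is read in COORDINATES: `𝔸_{M,f}`
and `𝔸_{L,f}` carry the `𝔸_{ℚ,f}`-MODULE TOPOLOGY (the «and topologically» clause of [CasselsFrohlichANT1967] Ch. II §14
Lemma (14.2) — the tree's instance ★ `IsDedekindDomain.FiniteAdeleRing.instIsModuleTopology…` of
★ `FiniteAdeleBaseChange`, for the scoped algebra `Algebra 𝔸_{ℚ,f} 𝔸_{M,f}` of ★ `NumberFieldAdeleBaseChange`), so every
`𝔸_{ℚ,f}`-linear map out of them is continuous (Mathlib ★ `IsModuleTopology.continuous_of_linearMap`); and the matrix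
entries of `ũ_β(a, t)` are `𝔸_{ℚ,f}`-linear coordinate functionals applied to products of `t`, of the entries of `a`
pushed along `j : L → M`, and of constants.

* `ratFiniteAdeleTensorEquiv_symm_algebraMap_mul` — `e⁻¹(r·y) = r • e⁻¹(y)`: `𝔸_{ℚ,f} ⊗ M ≅ 𝔸_{M,f}` is `𝔸_{ℚ,f}`-linear;
  `continuous_basis_repr_ratFiniteAdeleTensorEquiv_symm` — the coordinate functionals `y ↦ (e⁻¹ y)_k` in the basis
  `1 ⊗ b_k` are continuous.
* `finAdeleToTensor_algebraMap_finAdeleQ`, `continuous_ratFiniteAdeleTensorEquiv_finAdeleToTensor` — the push-forward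
  `𝔸_{L,f} → 𝔸_{M,f}` along `j` (★ `finAdeleToTensor` followed by `e`) is `𝔸_{ℚ,f}`-linear, hence continuous.
* **`continuous_coe_auxToGspFin`, `continuous_auxToGspFin F : Continuous (auxToGspFin F)`.**
* **`isOpen_auxLevel F (hm : m ≠ 0)`**, `isClosed_auxLevel`, and the slices `isOpen_setOf_mk_one_mem_auxLevel`
  (`{k | (k, 1) ∈ K̃(m)}` open in `U(H)(𝔸_f)`), `isOpen_setOf_one_mk_mem_auxLevel` (`{t | (1, t) ∈ K̃(m)}` open in
  `T₀(M)(𝔸_f)`) — the openness inputs of the product decomposition `K̃(m) = K_V(m) × L_V(m)` (a prover lemma, Q6b (iii)).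
* §4 `auxResFin M j H` — the FRAME-FREE carrier `(a, t) ↦ res(diag(t′, t′·X′)) ∈ GL_{(1⊕n)×[M:ℚ]}(𝔸_{ℚ,f})` (a `MonoidHom`
  with body), `coe_auxToGspFin_eq_conjRect` (`ũ_β = conjRect(P_β, Q_β) ∘ auxResFin`), **`continuous_auxResFin`** — the map
  to whose compact images the lattice stabilisation ★ `Adeles.exists_rat_conj_isCongOne_one` is applied (Q6b (i-b)).

## References
* [Deligne1979ShimuraVarieties] P. Deligne, *Variétés de Shimura* (1979), Prop. 2.3.10, 2.1.2 (PDF pp. 32, 24 of Milne's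
  translation: `u : G → CSp(V)` a morphism of algebraic groups, hence continuous on adelic points).
* [Deligne1971TravauxShimura] P. Deligne, *Travaux de Shimura* (1971), Prop. 1.15 p. 132 («`K₂ ⊃ u(K₁)` … compact ouvert»),
  Exemple 4.16 p. 150.
* [CasselsFrohlichANT1967] Cassels–Fröhlich, *Algebraic Number Theory*, Ch. II §14 Lemma (14.2) («algebraically and
  topologically»).
* [RapoportSmithlingZhang2020Diagonal] M. Rapoport, B. Smithling, W. Zhang, Compos. Math. 156 (2020), Remark 3.2 (ii)(iii) pp. 9–10.
-/

set_option autoImplicit false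

noncomputable section

open Matrix NumberField IsDedekindDomain
open _root_.Topology
open scoped TensorProduct NumberField.AdeleRing

namespace Literature.AlgebraicGeometry.ShimuraVarieties

namespace UnitaryCurve

namespace Aux

open Literature.AlgebraicGeometry.ModuliOfAbelianVarieties
open Literature.AlgebraicGeometry.ShimuraVarieties.UnitaryCanonicalModel.Aux (torusRat torusFinAdelic toTorusFinAdelic coe_toTorusFinAdelic)
open Literature.NumberTheory.ComplexMultiplication (ratFiniteAdeleTensorEquiv ratFiniteAdeleTensorEquiv_tmul
  ratFiniteAdeleTensorEquiv_one_tmul ratFiniteAdeleTensorEquiv_symm_algebraMap)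
open Literature.NumberTheory.Automorphic Literature.NumberTheory.Automorphic.UnitaryGroup

/-! ### §1. `𝔸_{ℚ,f}`-linearity and continuity of the coordinate functionals and of the push-forward along `j`: the rank-free ★ lemmas of
`UnitaryAuxiliarySymplecticLevel` (namespace `…UnitaryCanonicalModel.Aux`) are REUSED, not re-declared. -/

open Literature.AlgebraicGeometry.ShimuraVarieties.UnitaryCanonicalModel.Aux (conjAlgHom conjAlgHom_apply conjR conjR_tmul ratBasis trace_one_tmul
  finAdeleToTensor finAdeleToTensor_algebraMap torusToTensorFin basis_repr_map resMatrix_map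
  ratFiniteAdeleTensorEquiv_symm_algebraMap_mul continuous_basis_repr_ratFiniteAdeleTensorEquiv_symm finAdeleToTensor_algebraMap_finAdeleQ
  ratFiniteAdeleTensorEquiv_finAdeleToTensor_algebraMap_finAdeleQ continuous_ratFiniteAdeleTensorEquiv_finAdeleToTensor)

/-! ### §2. Continuity of `ũ_β = auxToGspFin F` -/

section Cont

variable {L : Type} [Field L] [NumberField L] [IsCMField L] {M : Type} [Field M] [NumberField M] [IsCMField M]
  {j : L →+* M} {n : ℕ} {H : Matrix (Fin n) (Fin n) L} {ξ₀ ξ : M} {g : ℕ} {δ : Fin g → ℕ}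

/-- The underlying matrix of `ũ_β(a, t)` is `P · res(diag(t′, t′·X′)) · Q` (unfolding). [cite: Deligne1979ShimuraVarieties, Prop. 2.3.10 (PDF p. 32)] -/
theorem coe_auxToGspFin_eq (F : SymplecticFrame M j H ξ₀ ξ g δ)
    (p : ↥(finAdelic (↥(maximalRealSubfield L)) L (IsCMField.complexConj L) n H) × ↥(torusFinAdelic M)) :
    ((auxToGspFin F p : GL (Fin g ⊕ Fin g) finAdeleQ) : Matrix (Fin g ⊕ Fin g) (Fin g ⊕ Fin g) finAdeleQ) =
      framePR finAdeleQ F *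
        resMatrix (Algebra.TensorProduct.basis finAdeleQ (ratBasis M))
          ((blockGL (finAdeleQ ⊗[ℚ] M) (torusToTensorFin M p.2, unitaryToTensorFin M j H p.1) :
              GL (Fin 1 ⊕ Fin n) (finAdeleQ ⊗[ℚ] M)) : Matrix (Fin 1 ⊕ Fin n) (Fin 1 ⊕ Fin n) (finAdeleQ ⊗[ℚ] M)) *
        frameQR finAdeleQ F := by
  obtain ⟨a, t⟩ := p
  rw [coe_auxToGspFin, auxRep, MonoidHom.comp_apply, MonoidHom.comp_apply, coe_conjRect, coe_resGL]

/-- **The matrix of `ũ_β(a, t)` depends continuously on `(a, t)`** — entrywise it is an `𝔸_{ℚ,f}`-linear coordinate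
functional of `𝔸_{M,f}` applied to `t · (j-push-forward of an entry of a) · (constant)`.
[cite: Deligne1979ShimuraVarieties, Prop. 2.3.10 (PDF p. 32)] [cite: CasselsFrohlichANT1967, Ch. II §14 Lemma (14.2)] -/
theorem continuous_coe_auxToGspFin (F : SymplecticFrame M j H ξ₀ ξ g δ) :
    Continuous fun p : ↥(finAdelic (↥(maximalRealSubfield L)) L (IsCMField.complexConj L) n H) × ↥(torusFinAdelic M) =>
      ((auxToGspFin F p : GL (Fin g ⊕ Fin g) finAdeleQ) : Matrix (Fin g ⊕ Fin g) (Fin g ⊕ Fin g) finAdeleQ) := by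
  -- the variable pieces over `𝔸_{M,f}`: the torus coordinate `t` and the push-forward `X` of `a` along `j`
  have hT : Continuous fun p : ↥(finAdelic (↥(maximalRealSubfield L)) L (IsCMField.complexConj L) n H) ×
      ↥(torusFinAdelic M) => (((p.2 : ↥(torusFinAdelic M)) : (FiniteAdeleRing (𝓞 M) M)ˣ) : FiniteAdeleRing (𝓞 M) M) :=
    Units.continuous_val.comp (continuous_subtype_val.comp continuous_snd)
  have hX : Continuous fun p : ↥(finAdelic (↥(maximalRealSubfield L)) L (IsCMField.complexConj L) n H) ×
      ↥(torusFinAdelic M) =>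
      ((((p.1 : ↥(finAdelic (↥(maximalRealSubfield L)) L (IsCMField.complexConj L) n H)) :
          GL (Fin n) (FiniteAdeleRing (𝓞 L) L)) : Matrix (Fin n) (Fin n) (FiniteAdeleRing (𝓞 L) L)).map
        fun y => ratFiniteAdeleTensorEquiv M (finAdeleToTensor M j y)) :=
    (Units.continuous_val.comp (continuous_subtype_val.comp continuous_fst)).matrix_map
      (continuous_ratFiniteAdeleTensorEquiv_finAdeleToTensor M j)
  have hBlk : Continuous fun p : ↥(finAdelic (↥(maximalRealSubfield L)) L (IsCMField.complexConj L) n H) ×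
      ↥(torusFinAdelic M) =>
      Matrix.fromBlocks
        ((((p.2 : ↥(torusFinAdelic M)) : (FiniteAdeleRing (𝓞 M) M)ˣ) : FiniteAdeleRing (𝓞 M) M) •
          (1 : Matrix (Fin 1) (Fin 1) (FiniteAdeleRing (𝓞 M) M)))
        0 0
        ((((p.2 : ↥(torusFinAdelic M)) : (FiniteAdeleRing (𝓞 M) M)ˣ) : FiniteAdeleRing (𝓞 M) M) •
          ((((p.1 : ↥(finAdelic (↥(maximalRealSubfield L)) L (IsCMField.complexConj L) n H)) :
              GL (Fin n) (FiniteAdeleRing (𝓞 L) L)) : Matrix (Fin n) (Fin n) (FiniteAdeleRing (𝓞 L) L)).map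
            fun y => ratFiniteAdeleTensorEquiv M (finAdeleToTensor M j y))) :=
    Continuous.matrix_fromBlocks (hT.smul continuous_const) continuous_const continuous_const (hT.smul hX)
  -- the restriction-of-scalars matrix, entry by entry
  have hres : Continuous fun p : ↥(finAdelic (↥(maximalRealSubfield L)) L (IsCMField.complexConj L) n H) ×
      ↥(torusFinAdelic M) =>
      resMatrix (Algebra.TensorProduct.basis finAdeleQ (ratBasis M))
        ((blockGL (finAdeleQ ⊗[ℚ] M) (torusToTensorFin M p.2, unitaryToTensorFin M j H p.1) :
            GL (Fin 1 ⊕ Fin n) (finAdeleQ ⊗[ℚ] M)) : Matrix (Fin 1 ⊕ Fin n) (Fin 1 ⊕ Fin n) (finAdeleQ ⊗[ℚ] M)) := by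
    refine continuous_matrix fun ik il => ?_
    obtain ⟨i, k⟩ := ik
    obtain ⟨i', l⟩ := il
    have heq : (fun p : ↥(finAdelic (↥(maximalRealSubfield L)) L (IsCMField.complexConj L) n H) ×
        ↥(torusFinAdelic M) =>
        resMatrix (Algebra.TensorProduct.basis finAdeleQ (ratBasis M))
          ((blockGL (finAdeleQ ⊗[ℚ] M) (torusToTensorFin M p.2, unitaryToTensorFin M j H p.1) :
              GL (Fin 1 ⊕ Fin n) (finAdeleQ ⊗[ℚ] M)) : Matrix (Fin 1 ⊕ Fin n) (Fin 1 ⊕ Fin n) (finAdeleQ ⊗[ℚ] M))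
          (i, k) (i', l)) =
        fun p => (Algebra.TensorProduct.basis finAdeleQ (ratBasis M)).repr
          ((ratFiniteAdeleTensorEquiv M).symm
            (Matrix.fromBlocks
                ((((p.2 : ↥(torusFinAdelic M)) : (FiniteAdeleRing (𝓞 M) M)ˣ) : FiniteAdeleRing (𝓞 M) M) •
                  (1 : Matrix (Fin 1) (Fin 1) (FiniteAdeleRing (𝓞 M) M)))
                0 0
                ((((p.2 : ↥(torusFinAdelic M)) : (FiniteAdeleRing (𝓞 M) M)ˣ) : FiniteAdeleRing (𝓞 M) M) •
                  ((((p.1 : ↥(finAdelic (↥(maximalRealSubfield L)) L (IsCMField.complexConj L) n H)) :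
                      GL (Fin n) (FiniteAdeleRing (𝓞 L) L)) : Matrix (Fin n) (Fin n) (FiniteAdeleRing (𝓞 L) L)).map
                    fun y => ratFiniteAdeleTensorEquiv M (finAdeleToTensor M j y)))
              i i' *
              algebraMap M (FiniteAdeleRing (𝓞 M) M) (ratBasis M l))) k := by
      funext p
      rw [resMatrix_apply]
      congr 2
      apply (ratFiniteAdeleTensorEquiv M).injective
      rw [RingEquiv.apply_symm_apply, map_mul, Algebra.TensorProduct.basis_apply, ratFiniteAdeleTensorEquiv_one_tmul]
      congr 1
      have hmap := coe_blockGL_map ((ratFiniteAdeleTensorEquiv M : finAdeleQ ⊗[ℚ] M ≃+* FiniteAdeleRing (𝓞 M) M) :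
          finAdeleQ ⊗[ℚ] M →+* FiniteAdeleRing (𝓞 M) M) (torusToTensorFin M p.2) (unitaryToTensorFin M j H p.1)
      have hentry := congrFun (congrFun hmap i) i'
      rw [Matrix.map_apply] at hentry
      rw [RingHom.coe_coe] at hentry
      rw [hentry, coe_blockGL]
      -- the scalar `e(t′) = t` in both blocks (`e ∘ e⁻¹ = id`); the matrix block agrees definitionally
      congr 2
      · congr 1
        exact Units.ext ((ratFiniteAdeleTensorEquiv M).apply_symm_apply _)
      · congr 1
        exact Units.ext ((ratFiniteAdeleTensorEquiv M).apply_symm_apply _)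
    rw [heq]
    exact (continuous_basis_repr_ratFiniteAdeleTensorEquiv_symm M k).comp ((hBlk.matrix_elem i i').mul continuous_const)
  have hfun : (fun p : ↥(finAdelic (↥(maximalRealSubfield L)) L (IsCMField.complexConj L) n H) × ↥(torusFinAdelic M) =>
      ((auxToGspFin F p : GL (Fin g ⊕ Fin g) finAdeleQ) : Matrix (Fin g ⊕ Fin g) (Fin g ⊕ Fin g) finAdeleQ)) =
      fun p => framePR finAdeleQ F *
        resMatrix (Algebra.TensorProduct.basis finAdeleQ (ratBasis M))
          ((blockGL (finAdeleQ ⊗[ℚ] M) (torusToTensorFin M p.2, unitaryToTensorFin M j H p.1) :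
              GL (Fin 1 ⊕ Fin n) (finAdeleQ ⊗[ℚ] M)) : Matrix (Fin 1 ⊕ Fin n) (Fin 1 ⊕ Fin n) (finAdeleQ ⊗[ℚ] M)) *
        frameQR finAdeleQ F := funext fun p => coe_auxToGspFin_eq F p
  rw [hfun]
  exact (continuous_const.matrix_mul hres).matrix_mul continuous_const

/-- **`ũ_β = auxToGspFin F : U(H)(𝔸_f) × T₀(M)(𝔸_f) → GSp_δ(𝔸_{ℚ,f})` is continuous** (units topology on both sides:
the matrix and the inverse matrix vary continuously, the latter because `ũ_β` is a group homomorphism).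
[cite: Deligne1979ShimuraVarieties, Prop. 2.3.10, 2.1.2 (PDF pp. 32, 24)] -/
theorem continuous_auxToGspFin (F : SymplecticFrame M j H ξ₀ ξ g δ) : Continuous (UnitaryCurve.Aux.auxToGspFin (n := n) F) := by
  rw [Topology.IsInducing.subtypeVal.continuous_iff, Units.continuous_iff]
  refine ⟨continuous_coe_auxToGspFin F, ?_⟩
  exact ((continuous_coe_auxToGspFin F).comp continuous_inv).congr fun p => by
    simp only [Function.comp_apply, map_inv, Subgroup.coe_inv]

end Cont

/-! ### §3. The auxiliary levels `K̃(m)` are open and closed; their slices are open -/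

section Level

variable {L : Type} [Field L] [NumberField L] [IsCMField L] {M : Type} [Field M] [NumberField M] [IsCMField M]
  {j : L →+* M} {n : ℕ} {H : Matrix (Fin n) (Fin n) L} {ξ₀ ξ : M} {g : ℕ} {δ : Fin g → ℕ}

/-- **`K̃(m) = ũ_β⁻¹(K_δ(m))` is OPEN in `U(H)(𝔸_f) × T₀(M)(𝔸_f)` for `m ≠ 0`** (preimage of the open `K_δ(m)`, ★
`isOpen_principalLevelSubgroup`, under the continuous `ũ_β`). [cite: Deligne1971TravauxShimura, Prop. 1.15 p. 132, Exemple 4.16 p. 150] -/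
theorem isOpen_auxLevel (F : SymplecticFrame M j H ξ₀ ξ g δ) {m : ℕ} (hm : m ≠ 0) :
    IsOpen (auxLevel F m :
      Set (↥(finAdelic (↥(maximalRealSubfield L)) L (IsCMField.complexConj L) n H) × ↥(torusFinAdelic M))) :=
  (isOpen_principalLevelSubgroup δ hm).preimage (continuous_auxToGspFin F)

/-- `K̃(m)` is closed for `m ≠ 0` (an open subgroup is closed). [cite: Deligne1971TravauxShimura, Prop. 1.15 p. 132] -/
theorem isClosed_auxLevel (F : SymplecticFrame M j H ξ₀ ξ g δ) {m : ℕ} (hm : m ≠ 0) :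
    IsClosed (auxLevel F m :
      Set (↥(finAdelic (↥(maximalRealSubfield L)) L (IsCMField.complexConj L) n H) × ↥(torusFinAdelic M))) :=
  Subgroup.isClosed_of_isOpen _ (isOpen_auxLevel F hm)

/-- **The unitary slice `{k | (k, 1) ∈ K̃(m)}` is open in `U(H)(𝔸_f)`** (`m ≠ 0`). [cite: Deligne1971TravauxShimura, Prop. 1.15 p. 132] -/
theorem isOpen_setOf_mk_one_mem_auxLevel (F : SymplecticFrame M j H ξ₀ ξ g δ) {m : ℕ} (hm : m ≠ 0) :
    IsOpen {k : ↥(finAdelic (↥(maximalRealSubfield L)) L (IsCMField.complexConj L) n H) | (k, 1) ∈ auxLevel F m} :=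
  (isOpen_auxLevel F hm).preimage (Continuous.prodMk_left 1)

/-- **The torus slice `{t | (1, t) ∈ K̃(m)}` is open in `T₀(M)(𝔸_f)`** (`m ≠ 0`). [cite: Deligne1971TravauxShimura, Prop. 1.15 p. 132] -/
theorem isOpen_setOf_one_mk_mem_auxLevel (F : SymplecticFrame M j H ξ₀ ξ g δ) {m : ℕ} (hm : m ≠ 0) :
    IsOpen {t : ↥(torusFinAdelic M) | (1, t) ∈ UnitaryCurve.Aux.auxLevel (n := n) F m} :=
  (isOpen_auxLevel F hm).preimage (Continuous.prodMk_right 1)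

/-- `(k, t) ∈ K̃(m)` splits as `ũ(1, t)·ũ(k, 1) ∈ K_δ(m)` (the group law; the two factors commute). [cite: Deligne1979ShimuraVarieties, Prop. 2.3.10 (PDF p. 32)] -/
theorem auxToGspFin_eq_mul (F : SymplecticFrame M j H ξ₀ ξ g δ)
    (k : ↥(finAdelic (↥(maximalRealSubfield L)) L (IsCMField.complexConj L) n H)) (t : ↥(torusFinAdelic M)) :
    auxToGspFin F (k, t) = auxToGspFin F (1, t) * auxToGspFin F (k, 1) := by
  rw [← map_mul, Prod.mk_mul_mk, one_mul, mul_one]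

/-- If the slices lie in `K̃(m)` then so does the pair. [cite: Deligne1971TravauxShimura, Prop. 1.15 p. 132] -/
theorem mk_mem_auxLevel_of_slices (F : SymplecticFrame M j H ξ₀ ξ g δ) {m : ℕ}
    {k : ↥(finAdelic (↥(maximalRealSubfield L)) L (IsCMField.complexConj L) n H)} {t : ↥(torusFinAdelic M)}
    (hk : (k, 1) ∈ auxLevel F m) (ht : (1, t) ∈ auxLevel F m) : (k, t) ∈ auxLevel F m := by
  have h := Subgroup.mul_mem _ ht hk
  rwa [Prod.mk_mul_mk, one_mul, mul_one] at h

end Level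

/-! ### §4. The frame-free restriction-of-scalars carrier (input of the lattice stabilisation, Q6b (i-b)) -/

section ResCarrier

variable {L : Type} [Field L] [NumberField L] [IsCMField L] (M : Type) [Field M] [NumberField M] [IsCMField M]
  (j : L →+* M) {n : ℕ} (H : Matrix (Fin n) (Fin n) L)

/-- **The frame-free carrier `(a, t) ↦ res(diag(t′, t′·X′)) ∈ GL_{(1⊕n)×[M:ℚ]}(𝔸_{ℚ,f})`**: restriction of scalars of the
block embedding `diag(t′, t′·X′)` (★ `blockGL`, fed by the transports ★ `torusToTensorFin`, ★ `unitaryToTensorFin`) along the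
basis `eᵢ ⊗ (1 ⊗ b_k)` of `(𝔸_{ℚ,f} ⊗_ℚ M)^{1⊕n}` (★ `resGL`), BEFORE reading it in a symplectic frame —
`ũ_β = conjRect(P_β, Q_β) ∘ auxResFin` (`coe_auxToGspFin_eq_conjRect`).  Its compact images are what a lattice-stabilisation
argument (★ `Adeles.exists_rat_conj_isCongOne_one`) is applied to. [cite: Deligne1979ShimuraVarieties, Prop. 2.3.10 (PDF p. 32)]
[cite: Deligne1971TravauxShimura, 4.9 p. 147 («restriction des scalaires»)] -/
def auxResFin :
    ↥(finAdelic (↥(maximalRealSubfield L)) L (IsCMField.complexConj L) n H) × ↥(torusFinAdelic M) →*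
      GL ((Fin 1 ⊕ Fin n) × Fin (Module.finrank ℚ M)) finAdeleQ :=
  (resGL (m := Fin 1 ⊕ Fin n) (Algebra.TensorProduct.basis finAdeleQ (ratBasis M))).comp
    ((blockGL (finAdeleQ ⊗[ℚ] M)).comp
      (MonoidHom.prod ((torusToTensorFin M).comp (MonoidHom.snd _ _))
        ((unitaryToTensorFin M j H).comp (MonoidHom.fst _ _))))

/-- Underlying matrix of `auxResFin (a, t)`: `resMatrix B (diag(t′, t′·X′))`. [cite: Deligne1971TravauxShimura, 4.9 p. 147] -/
theorem coe_auxResFin (p : ↥(finAdelic (↥(maximalRealSubfield L)) L (IsCMField.complexConj L) n H) × ↥(torusFinAdelic M)) :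
    ((auxResFin M j H p : GL ((Fin 1 ⊕ Fin n) × Fin (Module.finrank ℚ M)) finAdeleQ) :
        Matrix ((Fin 1 ⊕ Fin n) × Fin (Module.finrank ℚ M)) ((Fin 1 ⊕ Fin n) × Fin (Module.finrank ℚ M)) finAdeleQ) =
      resMatrix (Algebra.TensorProduct.basis finAdeleQ (ratBasis M))
        ((blockGL (finAdeleQ ⊗[ℚ] M) (torusToTensorFin M p.2, unitaryToTensorFin M j H p.1) :
            GL (Fin 1 ⊕ Fin n) (finAdeleQ ⊗[ℚ] M)) : Matrix (Fin 1 ⊕ Fin n) (Fin 1 ⊕ Fin n) (finAdeleQ ⊗[ℚ] M)) :=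
  rfl

variable {M j H} in
/-- **`ũ_β = conjRect(P_β, Q_β) ∘ auxResFin`**: the framed carrier ★ `auxToGspFin F` is the frame-free one read in the
symplectic frame. [cite: Deligne1979ShimuraVarieties, Prop. 2.3.10 (PDF p. 32)] -/
theorem coe_auxToGspFin_eq_conjRect {ξ₀ ξ : M} {g : ℕ} {δ : Fin g → ℕ} (F : SymplecticFrame M j H ξ₀ ξ g δ)
    (p : ↥(finAdelic (↥(maximalRealSubfield L)) L (IsCMField.complexConj L) n H) × ↥(torusFinAdelic M)) :
    (auxToGspFin F p : GL (Fin g ⊕ Fin g) finAdeleQ) =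
      conjRect (framePR finAdeleQ F) (frameQR finAdeleQ F) (framePR_mul_frameQR finAdeleQ F)
        (frameQR_mul_framePR finAdeleQ F) (auxResFin M j H p) := by
  obtain ⟨a, t⟩ := p
  rfl

/-- **The matrix of `auxResFin (a, t)` depends continuously on `(a, t)`** (entrywise an `𝔸_{ℚ,f}`-linear coordinate
functional of `𝔸_{M,f}` applied to `t · (j-push-forward of an entry of a) · (constant)`; same argument as
★ `continuous_coe_auxToGspFin`, without the frame). [cite: CasselsFrohlichANT1967, Ch. II §14 Lemma (14.2)] -/
theorem continuous_coe_auxResFin :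
    Continuous fun p : ↥(finAdelic (↥(maximalRealSubfield L)) L (IsCMField.complexConj L) n H) × ↥(torusFinAdelic M) =>
      ((auxResFin M j H p : GL ((Fin 1 ⊕ Fin n) × Fin (Module.finrank ℚ M)) finAdeleQ) :
        Matrix ((Fin 1 ⊕ Fin n) × Fin (Module.finrank ℚ M)) ((Fin 1 ⊕ Fin n) × Fin (Module.finrank ℚ M)) finAdeleQ) := by
  -- the variable pieces over `𝔸_{M,f}`: the torus coordinate `t` and the push-forward `X` of `a` along `j`
  have hT : Continuous fun p : ↥(finAdelic (↥(maximalRealSubfield L)) L (IsCMField.complexConj L) n H) ×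
      ↥(torusFinAdelic M) => (((p.2 : ↥(torusFinAdelic M)) : (FiniteAdeleRing (𝓞 M) M)ˣ) : FiniteAdeleRing (𝓞 M) M) :=
    Units.continuous_val.comp (continuous_subtype_val.comp continuous_snd)
  have hX : Continuous fun p : ↥(finAdelic (↥(maximalRealSubfield L)) L (IsCMField.complexConj L) n H) ×
      ↥(torusFinAdelic M) =>
      ((((p.1 : ↥(finAdelic (↥(maximalRealSubfield L)) L (IsCMField.complexConj L) n H)) :
          GL (Fin n) (FiniteAdeleRing (𝓞 L) L)) : Matrix (Fin n) (Fin n) (FiniteAdeleRing (𝓞 L) L)).map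
        fun y => ratFiniteAdeleTensorEquiv M (finAdeleToTensor M j y)) :=
    (Units.continuous_val.comp (continuous_subtype_val.comp continuous_fst)).matrix_map
      (continuous_ratFiniteAdeleTensorEquiv_finAdeleToTensor M j)
  have hBlk : Continuous fun p : ↥(finAdelic (↥(maximalRealSubfield L)) L (IsCMField.complexConj L) n H) ×
      ↥(torusFinAdelic M) =>
      Matrix.fromBlocks
        ((((p.2 : ↥(torusFinAdelic M)) : (FiniteAdeleRing (𝓞 M) M)ˣ) : FiniteAdeleRing (𝓞 M) M) •
          (1 : Matrix (Fin 1) (Fin 1) (FiniteAdeleRing (𝓞 M) M)))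
        0 0
        ((((p.2 : ↥(torusFinAdelic M)) : (FiniteAdeleRing (𝓞 M) M)ˣ) : FiniteAdeleRing (𝓞 M) M) •
          ((((p.1 : ↥(finAdelic (↥(maximalRealSubfield L)) L (IsCMField.complexConj L) n H)) :
              GL (Fin n) (FiniteAdeleRing (𝓞 L) L)) : Matrix (Fin n) (Fin n) (FiniteAdeleRing (𝓞 L) L)).map
            fun y => ratFiniteAdeleTensorEquiv M (finAdeleToTensor M j y))) :=
    Continuous.matrix_fromBlocks (hT.smul continuous_const) continuous_const continuous_const (hT.smul hX)
  -- the restriction-of-scalars matrix, entry by entry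
  have hres : Continuous fun p : ↥(finAdelic (↥(maximalRealSubfield L)) L (IsCMField.complexConj L) n H) ×
      ↥(torusFinAdelic M) =>
      resMatrix (Algebra.TensorProduct.basis finAdeleQ (ratBasis M))
        ((blockGL (finAdeleQ ⊗[ℚ] M) (torusToTensorFin M p.2, unitaryToTensorFin M j H p.1) :
            GL (Fin 1 ⊕ Fin n) (finAdeleQ ⊗[ℚ] M)) : Matrix (Fin 1 ⊕ Fin n) (Fin 1 ⊕ Fin n) (finAdeleQ ⊗[ℚ] M)) := by
    refine continuous_matrix fun ik il => ?_
    obtain ⟨i, k⟩ := ik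
    obtain ⟨i', l⟩ := il
    have heq : (fun p : ↥(finAdelic (↥(maximalRealSubfield L)) L (IsCMField.complexConj L) n H) ×
        ↥(torusFinAdelic M) =>
        resMatrix (Algebra.TensorProduct.basis finAdeleQ (ratBasis M))
          ((blockGL (finAdeleQ ⊗[ℚ] M) (torusToTensorFin M p.2, unitaryToTensorFin M j H p.1) :
              GL (Fin 1 ⊕ Fin n) (finAdeleQ ⊗[ℚ] M)) : Matrix (Fin 1 ⊕ Fin n) (Fin 1 ⊕ Fin n) (finAdeleQ ⊗[ℚ] M))
          (i, k) (i', l)) =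
        fun p => (Algebra.TensorProduct.basis finAdeleQ (ratBasis M)).repr
          ((ratFiniteAdeleTensorEquiv M).symm
            (Matrix.fromBlocks
                ((((p.2 : ↥(torusFinAdelic M)) : (FiniteAdeleRing (𝓞 M) M)ˣ) : FiniteAdeleRing (𝓞 M) M) •
                  (1 : Matrix (Fin 1) (Fin 1) (FiniteAdeleRing (𝓞 M) M)))
                0 0
                ((((p.2 : ↥(torusFinAdelic M)) : (FiniteAdeleRing (𝓞 M) M)ˣ) : FiniteAdeleRing (𝓞 M) M) •
                  ((((p.1 : ↥(finAdelic (↥(maximalRealSubfield L)) L (IsCMField.complexConj L) n H)) :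
                      GL (Fin n) (FiniteAdeleRing (𝓞 L) L)) : Matrix (Fin n) (Fin n) (FiniteAdeleRing (𝓞 L) L)).map
                    fun y => ratFiniteAdeleTensorEquiv M (finAdeleToTensor M j y)))
              i i' *
              algebraMap M (FiniteAdeleRing (𝓞 M) M) (ratBasis M l))) k := by
      funext p
      rw [resMatrix_apply]
      congr 2
      apply (ratFiniteAdeleTensorEquiv M).injective
      rw [RingEquiv.apply_symm_apply, map_mul, Algebra.TensorProduct.basis_apply, ratFiniteAdeleTensorEquiv_one_tmul]
      congr 1
      have hmap := coe_blockGL_map ((ratFiniteAdeleTensorEquiv M : finAdeleQ ⊗[ℚ] M ≃+* FiniteAdeleRing (𝓞 M) M) :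
          finAdeleQ ⊗[ℚ] M →+* FiniteAdeleRing (𝓞 M) M) (torusToTensorFin M p.2) (unitaryToTensorFin M j H p.1)
      have hentry := congrFun (congrFun hmap i) i'
      rw [Matrix.map_apply] at hentry
      rw [RingHom.coe_coe] at hentry
      rw [hentry, coe_blockGL]
      -- the scalar `e(t′) = t` in both blocks (`e ∘ e⁻¹ = id`); the matrix block agrees definitionally
      congr 2
      · congr 1
        exact Units.ext ((ratFiniteAdeleTensorEquiv M).apply_symm_apply _)
      · congr 1
        exact Units.ext ((ratFiniteAdeleTensorEquiv M).apply_symm_apply _)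
    rw [heq]
    exact (continuous_basis_repr_ratFiniteAdeleTensorEquiv_symm M k).comp ((hBlk.matrix_elem i i').mul continuous_const)
  exact hres

/-- **`auxResFin M j H : U(H)(𝔸_f) × T₀(M)(𝔸_f) → GL_{(1⊕n)×[M:ℚ]}(𝔸_{ℚ,f})` is continuous** (units topology; the inverse
matrix via the homomorphism property). [cite: Deligne1979ShimuraVarieties, Prop. 2.3.10 (PDF p. 32)] -/
theorem continuous_auxResFin : Continuous (auxResFin M j H) := by
  rw [Units.continuous_iff]
  refine ⟨continuous_coe_auxResFin M j H, ?_⟩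
  exact ((continuous_coe_auxResFin M j H).comp continuous_inv).congr fun p => by
    simp only [Function.comp_apply, map_inv]

end ResCarrier

end Aux

end UnitaryCurve

end Literature.AlgebraicGeometry.ShimuraVarieties

end
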